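import Literature.NumberTheory.Automorphic.GL2EllipticCompactSupport
import Literature.NumberTheory.Automorphic.QuaternionUnitsTraceNormalized
import Literature.MeasureTheory.Group.InvariantQuotientNormalizedPartial
import HarnessLib

/-!
# The elliptic terms of the trace formula for `GL₂` with the printed volumes
`Σ_{c ∈ 𝒞} meas(Z_∞⁺ G(γ_c)_ℚ \ G(γ_c)_𝔸) ∫_{G(γ_c)_𝔸 \ G_𝔸} Φ_A(y γ_c y⁻¹) dy`
(Gelbart, *Automorphic forms on adele groups* (1975), Prop. 9.10, Thm. 9.22 (ii) and (10.15);
p. 155: "Tamagawa measures being taken on both sides")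

Topic `NumberTheory/Automorphic`; theorems only (no definition, no named fact, no instance visible
to importers). `GL2EllipticTorus` and `GL2EllipticCompactSupport` proved the elliptic part of the
geometric side for `GL₂` over a number field `K` with UNSPECIFIED constants `d_c ∈ (0, ∞)` and
measures `μ_c`; the term-by-term comparison with the `D^×` side ((10.14), in the tree as
`QuaternionUnitsTraceNormalized` with the printed constants) needs the printed volume factors on the
`GL₂` side as well. This file supplies them, exactly as `QuaternionUnitsTraceNormalized` does for
`D^×`, from the generic `Literature.MeasureTheory.Group.lintegral_conjTsum_mk_mem_eq_mul_tsum_covol_mul`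
(`InvariantQuotientNormalizedPartial`):

* `GL2.isMulRightInvariant_centralizer`, `GL2.isInvInvariant_centralizer` — every Haar measure on the
  centraliser `G(γ)_𝔸 = C_{GL₂(𝔸_K)}(γ)` of an elliptic regular `γ ∈ GL₂(K)` is two-sided and inversion
  invariant (the torus is abelian, `GL2.centralizer_toAdelic_comm`).
* `GL2.exists_restricted_haar_elliptic` — the restricted Haar measures `ρ_{H,c} = (α ⊗ counting)|_{H_c}`
  on `H_c = ℝ_{>0} GL₂(K) ∩ G(γ_c)_𝔸` and their transports `ρ_{F,c}` to `H_c ≤ G(γ_c)_𝔸` exist with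
  the required invariances (non-vacuity of the parameters).
* `GL2.lintegral_conjTsum_elliptic_eq_mul_tsum_covol_mul` — **the `[0, ∞]`-valued elliptic terms
  with the printed constants**: for an automorphic `μ` on `X = GL₂(𝔸_K) ⧸ ℝ_{>0} GL₂(K)`, Haar
  measures `ν` on `GL₂(𝔸_K)` and `ρ₀` on `L = ℝ_{>0} GL₂(K)`, a set `𝒞` of elliptic regular classes
  and Haar measures `ν_c` on the tori `G(γ_c)_𝔸`,
  `∫_X Σ'_{γ ∈ GL₂(K), [γ] ∈ 𝒞} F(x̃ γ x̃⁻¹) dμ = c_μ · Σ'_{c ∈ 𝒞} vol(G(γ_c)_𝔸 ⧸ H_c) ·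
  ∫_{GL₂(𝔸_K) ⧸ G(γ_c)_𝔸} F(y γ_c y⁻¹) d(ν/ν_c)` for Borel `F ≥ 0`, with `c_μ = unfoldingConstant L ρ₀ μ ν`
  (`= 1` for `μ = ν/ρ₀`), `ν/ν_c` the quotient measure with Weil constant one and
  `vol(G(γ_c)_𝔸 ⧸ H_c)` the covolume of `ℝ_{>0} GL₂(K)_{γ_c}` in `G(γ_c)_𝔸 = E_𝔸ˣ` — Gelbart's
  `meas(Z_∞⁺ G(γ)_ℚ \ G(γ)_𝔸)` = `meas(Z_𝔸 B_F \ B_𝔸)` of (10.15).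
* `GL2.integral_conjTsum_elliptic_eq_tsum_covol_mul` — **the same for complex test functions**
  `Φ ∈ C_c(GL₂(𝔸_K))`, `Φ_A(g) = ∫_{A_G} Φ(a⁻¹ g) dα`, with integrability of the elliptic kernel and
  absolute convergence of the class sum (`GL2.lintegral_conjTsum_elliptic_enorm_lt_top`, Gelbart
  Lemma 9.9 / Prop. 9.10).

Part of the inline (D-0026) decomposition of
`Literature.NumberTheory.Automorphic.jacquetLanglands_transfer_exists` (Gelbart Thm. 10.5 via
(10.14) = (10.15)). Not treated: the identification of the tori and of their measures on the two
sides (`E_𝔸ˣ ↪ D_𝔸ˣ` and `E_𝔸ˣ ↪ GL₂(𝔸_K)`, Gelbart pp. 154–155), and the non-elliptic terms.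

## References

* S. Gelbart, *Automorphic forms on adele groups*, Ann. of Math. Studies 83 (1975), Prop. 9.10,
  Thm. 9.22 (ii), (10.15), pp. 154–155 [Gelbart1975].
-/

noncomputable section

open NumberField IsDedekindDomain MeasureTheory Measure Topology
open Literature.MeasureTheory.Group
open scoped NNReal ENNReal Pointwise MatrixGroups

namespace Literature.NumberTheory.Automorphic

-- the coset spaces carry Borel σ-algebras supplied locally, not the quotient σ-algebra
attribute [-instance] Quotient.instMeasurableSpace QuotientGroup.measurableSpace

section GL2

variable (K : Type) [Field K] [NumberField K]

local notation "𝔸K" => AdeleRing (𝓞 K) K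
local notation "M₂" => Matrix (Fin 2) (Fin 2) K
local notation "G₂" => AdelicGroupData.gl 2 K

attribute [local instance] adelicBorel borelSpace_adelic locallyCompactSpace_adelic
  secondCountableTopology_gl_adelic

attribute [local instance] AdelicGroupData.measurableSpaceQuotientForm
  AdelicGroupData.borelSpaceQuotientForm AdelicGroupData.smulInvariantMeasureQuotientForm
  AdelicGroupData.isFiniteMeasureOnCompactsQuotientForm AdelicGroupData.isFiniteMeasureQuotientForm

/-! ### Haar measures on the elliptic tori are two-sided -/

/-- **Every Haar measure on the torus `G(γ)_𝔸 = C_{GL₂(𝔸_K)}(γ)` of an elliptic regular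
`γ ∈ GL₂(K)` is right invariant** (the torus is abelian). [cite: Gelbart1975, Thm. 9.22 (ii)] -/
theorem GL2.isMulRightInvariant_centralizer (γ : GL (Fin 2) K)
    (hirr : Irreducible (Matrix.charpoly (γ : M₂)))
    (ν₀ : Measure (Subgroup.centralizer ({(G₂).toAdelic γ} : Set (G₂).Adelic))) [IsHaarMeasure ν₀] :
    ν₀.IsMulRightInvariant :=
  isMulRightInvariant_of_comm (Subgroup.centralizer ({(G₂).toAdelic γ} : Set (G₂).Adelic))
    (GL2.centralizer_toAdelic_comm K γ hirr) ν₀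

/-- **Every Haar measure on the torus of an elliptic regular `γ ∈ GL₂(K)` is inversion invariant**
(two-sided Haar measure on a closed subgroup of the second countable locally compact `GL₂(𝔸_K)`).
[cite: Gelbart1975, Thm. 9.22 (ii)] -/
theorem GL2.isInvInvariant_centralizer (γ : GL (Fin 2) K)
    (hirr : Irreducible (Matrix.charpoly (γ : M₂)))
    (ν₀ : Measure (Subgroup.centralizer ({(G₂).toAdelic γ} : Set (G₂).Adelic))) [IsHaarMeasure ν₀] :
    ν₀.IsInvInvariant := by
  haveI : IsClosed ((Subgroup.centralizer ({(G₂).toAdelic γ} : Set (G₂).Adelic) :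
    Subgroup (G₂).Adelic) : Set (G₂).Adelic) := isClosed_centralizer_singleton _
  haveI := GL2.isMulRightInvariant_centralizer K γ hirr ν₀
  exact isInvInvariant_of_isMulRightInvariant ν₀

/-! ### The elliptic terms with the printed volumes -/

/-- **The `[0, ∞]`-valued elliptic terms of the trace formula for `GL₂` with the printed volumes**
(Gelbart (1975), Thm. 9.22 (ii): `Σ_{γ ∈ {G_e}} meas(Z_∞⁺ G(γ)_ℚ \ G(γ)_𝔸) ∫_{G(γ)_𝔸 \ G_𝔸} f(x⁻¹ γ x)
dx`; (10.15): `½ Σ_Q Σ_{γ ∈ Z_F \ B_F, γ ∉ Z_F} meas(Z_𝔸 B_F \ B_𝔸) ∫_{B_𝔸 \ G_𝔸} Φ(x⁻¹ γ x) dx`). Let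
`μ` be an automorphic measure on `X = GL₂(𝔸_K) ⧸ ℝ_{>0} GL₂(K)`, `ν` a Haar measure on `GL₂(𝔸_K)`
(two-sided, `GL₂(𝔸_K)` being unimodular), `ρ₀` a Haar measure on `L = ℝ_{>0} GL₂(K)`, and `𝒞` a set
of conjugacy classes of `GL₂(K)` each represented by an element of irreducible characteristic
polynomial; for `c ∈ 𝒞` let `γ_c = out c`, `G_c = C(γ_c)` (the torus `E_𝔸ˣ`, closed, abelian),
`H_c = L ∩ G_c`, `ν_c` a Haar measure on `G_c` (two-sided and inversion invariant,
`GL2.isMulRightInvariant_centralizer`), `ρ_{H,c} = ρ₀|_{H_c}` (`Measure.comap` along `H_c ↪ L`) and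
`ρ_{F,c}` its transport to `H_c ≤ G_c`. Then for every Borel `F : GL₂(𝔸_K) → [0, ∞]`

  `∫_X Σ'_{γ ∈ GL₂(K), [γ] ∈ 𝒞} F(x̃ γ x̃⁻¹) dμ(x)
     = c_μ · Σ'_{c ∈ 𝒞} vol(G_c ⧸ H_c) · ∫_{GL₂(𝔸_K) ⧸ G_c} F(y γ_c y⁻¹) d(ν/ν_c)(y)`

with `c_μ = unfoldingConstant L ρ₀ μ ν` (Weil's constant of `μ`; `= 1` for `μ = ν/ρ₀`),
`ν/ν_c = quotientMeasure G_c ν_c ν` and `vol(G_c ⧸ H_c)` the total mass of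
`quotientMeasure (H_c ⊓ G_c) ρ_{F,c} ν_c` — Gelbart's `meas(Z_∞⁺ G(γ)_ℚ \ G(γ)_𝔸)`. All per-class
inputs are proved (`GL2.compactSpace_centralizer_quotient`, closedness, relative openness of
`H_c` in `L`); the instance binders (`L` closed: `instIsClosedQuotientSubgroup`; centralisers
closed: `isClosed_centralizer_singleton`; `ν` right invariant:
`GLn.isMulRightInvariant_of_isHaarMeasure_adelic_holds`) are all theorems of the tree and appear as
binders only because the quotient measures in the statement are keyed on them. Nothing is asserted
about the non-elliptic classes.
[cite: Gelbart1975, Thm. 9.22 (ii) and (10.15)] -/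
theorem GL2.lintegral_conjTsum_elliptic_eq_mul_tsum_covol_mul
    [∀ γ : (G₂).Adelic, MeasurableSpace ((G₂).Adelic ⧸
      Subgroup.centralizer ({γ} : Set (G₂).Adelic))]
    [∀ γ : (G₂).Adelic, BorelSpace ((G₂).Adelic ⧸ Subgroup.centralizer ({γ} : Set (G₂).Adelic))]
    [∀ γ : (G₂).Adelic, MeasurableSpace (↥(Subgroup.centralizer ({γ} : Set (G₂).Adelic)) ⧸
      ((G₂).quotientSubgroup ⊓ Subgroup.centralizer ({γ} : Set (G₂).Adelic)).subgroupOf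
        (Subgroup.centralizer ({γ} : Set (G₂).Adelic)))]
    [∀ γ : (G₂).Adelic, BorelSpace (↥(Subgroup.centralizer ({γ} : Set (G₂).Adelic)) ⧸
      ((G₂).quotientSubgroup ⊓ Subgroup.centralizer ({γ} : Set (G₂).Adelic)).subgroupOf
        (Subgroup.centralizer ({γ} : Set (G₂).Adelic)))]
    [hH : IsClosed ((G₂).quotientSubgroup : Set (G₂).Adelic)]
    [hCcl : ∀ γ : (G₂).Adelic, IsClosed ((Subgroup.centralizer ({γ} : Set (G₂).Adelic) :
      Subgroup (G₂).Adelic) : Set (G₂).Adelic)]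
    (μ : Measure (G₂).automorphicQuotient) [(G₂).IsAutomorphicMeasure μ]
    (ν : Measure (G₂).Adelic) [IsHaarMeasure ν] [ν.IsMulRightInvariant]
    (ρ₀ : Measure (G₂).quotientSubgroup) [ρ₀.IsHaarMeasure] [SFinite ρ₀]
    (𝒞 : Set (ConjClasses (G₂).arithmeticSubgroup))
    (h𝒞 : ∀ c ∈ 𝒞, ∃ g : GL (Fin 2) K, Matrix.GeneralLinearGroup.map (algebraMap K 𝔸K) g =
      ((Quotient.out c : (G₂).arithmeticSubgroup) : (G₂).Adelic) ∧
        Irreducible (Matrix.charpoly (g : M₂)))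
    (ρH : ∀ c : 𝒞, Measure ↥((G₂).quotientSubgroup ⊓ Subgroup.centralizer
      ({((Quotient.out (c : ConjClasses (G₂).arithmeticSubgroup) : (G₂).arithmeticSubgroup) :
        (G₂).Adelic)} : Set (G₂).Adelic)))
    [∀ c, IsHaarMeasure (ρH c)] [∀ c, (ρH c).IsInvInvariant] [∀ c, SFinite (ρH c)]
    (ρF : ∀ c : 𝒞, Measure ↥(((G₂).quotientSubgroup ⊓ Subgroup.centralizer
      ({((Quotient.out (c : ConjClasses (G₂).arithmeticSubgroup) : (G₂).arithmeticSubgroup) :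
        (G₂).Adelic)} : Set (G₂).Adelic)).subgroupOf (Subgroup.centralizer
          ({((Quotient.out (c : ConjClasses (G₂).arithmeticSubgroup) : (G₂).arithmeticSubgroup) :
            (G₂).Adelic)} : Set (G₂).Adelic))))
    [∀ c, IsHaarMeasure (ρF c)] [∀ c, (ρF c).IsInvInvariant] [∀ c, SFinite (ρF c)]
    (νC : ∀ c : 𝒞, Measure ↥(Subgroup.centralizer
      ({((Quotient.out (c : ConjClasses (G₂).arithmeticSubgroup) : (G₂).arithmeticSubgroup) :
        (G₂).Adelic)} : Set (G₂).Adelic)))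
    [∀ c, IsHaarMeasure (νC c)] [∀ c, (νC c).IsMulRightInvariant] [∀ c, (νC c).IsInvInvariant]
    [∀ c, SFinite (νC c)]
    (hρH : ∀ c, ρH c = ρ₀.comap (Subgroup.inclusion inf_le_left))
    (hρF : ∀ c, ρF c = Measure.map (Subgroup.subgroupOfEquivOfLe inf_le_right).symm (ρH c))
    {F : (G₂).Adelic → ℝ≥0∞} (hF : Measurable F) :
    ∫⁻ x, conjTsum (G₂).quotientSubgroup
        (((↑) : (G₂).arithmeticSubgroup → (G₂).Adelic) ''
          {γ : (G₂).arithmeticSubgroup | ConjClasses.mk γ ∈ 𝒞})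
        (conj_mem_of_mk_mem (G₂).arithmeticSubgroup 𝒞 (G₂).quotientSubgroup
          (AdelicGroupData.exists_inv_mul_mem_centralizer_quotientSubgroup (G₂))) F x ∂μ =
      unfoldingConstant (G₂).quotientSubgroup ρ₀ μ ν *
        ∑' c : 𝒞,
          quotientMeasure (((G₂).quotientSubgroup ⊓ Subgroup.centralizer
              ({((Quotient.out (c : ConjClasses (G₂).arithmeticSubgroup) :
                (G₂).arithmeticSubgroup) : (G₂).Adelic)} : Set (G₂).Adelic)).subgroupOf
              (Subgroup.centralizer ({((Quotient.out (c : ConjClasses (G₂).arithmeticSubgroup) :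
                (G₂).arithmeticSubgroup) : (G₂).Adelic)} : Set (G₂).Adelic))) (ρF c)
              (isClosed_subgroupOf _ _ (hH.inter (hCcl _))) (νC c) Set.univ *
            ∫⁻ y, descConj ((Quotient.out (c : ConjClasses (G₂).arithmeticSubgroup) :
                (G₂).arithmeticSubgroup) : (G₂).Adelic)
              (Subgroup.centralizer ({((Quotient.out (c : ConjClasses (G₂).arithmeticSubgroup) :
                (G₂).arithmeticSubgroup) : (G₂).Adelic)} : Set (G₂).Adelic))
              (mem_centralizer_singleton_comm _) F y
              ∂quotientMeasure (Subgroup.centralizer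
                ({((Quotient.out (c : ConjClasses (G₂).arithmeticSubgroup) :
                  (G₂).arithmeticSubgroup) : (G₂).Adelic)} : Set (G₂).Adelic))
                (νC c) (hCcl _) ν := by
  classical
  have hdisc : (G₂).IsDiscreteRational := gl_isDiscreteRational_holds 2 K
  have hrep : ∀ c : ConjClasses (G₂).arithmeticSubgroup,
      ConjClasses.mk (Quotient.out c : (G₂).arithmeticSubgroup) = c := fun c => by
    rw [← ConjClasses.quotient_mk_eq_mk]; exact Quotient.out_eq c
  choose g hg hirr using h𝒞
  haveI : ∀ c : 𝒞, IsClosed ((Subgroup.centralizer ({((Quotient.out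
      (c : ConjClasses (G₂).arithmeticSubgroup) : (G₂).arithmeticSubgroup) : (G₂).Adelic)} :
        Set (G₂).Adelic) : Subgroup (G₂).Adelic) : Set (G₂).Adelic) := fun c => hCcl _
  haveI : ∀ c : 𝒞, IsClosed ((((G₂).quotientSubgroup ⊓ Subgroup.centralizer ({((Quotient.out
      (c : ConjClasses (G₂).arithmeticSubgroup) : (G₂).arithmeticSubgroup) : (G₂).Adelic)} :
        Set (G₂).Adelic)) : Subgroup (G₂).Adelic) : Set (G₂).Adelic) := fun c =>
    hH.inter (hCcl _)
  haveI : ∀ c : 𝒞, CompactSpace (↥(Subgroup.centralizer ({((Quotient.out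
      (c : ConjClasses (G₂).arithmeticSubgroup) : (G₂).arithmeticSubgroup) : (G₂).Adelic)} :
        Set (G₂).Adelic)) ⧸ ((G₂).quotientSubgroup ⊓ Subgroup.centralizer ({((Quotient.out
      (c : ConjClasses (G₂).arithmeticSubgroup) : (G₂).arithmeticSubgroup) : (G₂).Adelic)} :
        Set (G₂).Adelic)).subgroupOf (Subgroup.centralizer ({((Quotient.out
      (c : ConjClasses (G₂).arithmeticSubgroup) : (G₂).arithmeticSubgroup) : (G₂).Adelic)} :
        Set (G₂).Adelic))) := by
    rintro ⟨c, hc⟩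
    have h := GL2.compactSpace_centralizer_quotient K (g c hc) (hirr c hc)
    have hg' : (G₂).toAdelic (g c hc) = ((Quotient.out c : (G₂).arithmeticSubgroup) : (G₂).Adelic) :=
      hg c hc
    rw [hg'] at h
    exact h
  exact Literature.MeasureTheory.Group.lintegral_conjTsum_mk_mem_eq_mul_tsum_covol_mul
    (G₂).arithmeticSubgroup (G₂).quotientSubgroup (G₂).arithmeticSubgroup_le_quotientSubgroup
    (AdelicGroupData.exists_inv_mul_mem_centralizer_quotientSubgroup (G₂))
    (fun c => Quotient.out c) hrep 𝒞
    (fun c => (G₂).quotientSubgroup ⊓ Subgroup.centralizer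
      ({((Quotient.out (c : ConjClasses (G₂).arithmeticSubgroup) : (G₂).arithmeticSubgroup) :
        (G₂).Adelic)} : Set (G₂).Adelic))
    (fun c => Subgroup.centralizer
      ({((Quotient.out (c : ConjClasses (G₂).arithmeticSubgroup) : (G₂).arithmeticSubgroup) :
        (G₂).Adelic)} : Set (G₂).Adelic))
    (fun c g => mem_inf_centralizer_singleton_iff _ _ _) (fun c => inf_le_right)
    (fun c => mem_centralizer_singleton_comm _) μ ν ρ₀ ρH ρF νC
    (fun c => AdelicGroupData.isOpen_subgroupOf_quotientSubgroup_of_center'_le (G₂) hdisc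
      (centralRetraction 2 K) (continuous_centralRetraction 2 K) (centralRetraction_mem 2 K)
      (fun a ha => centralRetraction_eq_self 2 K ha) (fun γ hγ => centralRetraction_eq_one 2 K hγ)
      (AdelicGroupData.center'_le_inf_centralizer (G₂) _))
    (AdelicGroupData.IsAutomorphicMeasure.ne_zero (G₂) μ) hρH hρF hF

/-- **The restricted Haar measures exist** (non-vacuity of the parameters `ρ_{H,c}`, `ρ_{F,c}`): for
a Haar measure `α` on `A_G = ℝ_{>0}`, the restriction `ρ_{H,c} = (α ⊗ counting)|_{H_c}` of the Haar
measure `((a, γ) ↦ a γ)_* (α ⊗ counting)` of `L = ℝ_{>0} GL₂(K)` to `H_c = L ∩ G(γ_c)_𝔸` (relatively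
open in `L`) is a Haar measure of `H_c`, inversion invariant and s-finite, and so is its transport
`ρ_{F,c}` to `H_c ≤ G(γ_c)_𝔸` — for the classes `c` of any set `𝒞` (proof verbatim that of
`units_exists_restricted_haar`). [folklore] -/
theorem GL2.exists_restricted_haar_elliptic
    [hH : IsClosed ((G₂).quotientSubgroup : Set (G₂).Adelic)]
    [hCcl : ∀ γ : (G₂).Adelic, IsClosed ((Subgroup.centralizer ({γ} : Set (G₂).Adelic) :
      Subgroup (G₂).Adelic) : Set (G₂).Adelic)]
    (𝒞 : Set (ConjClasses (G₂).arithmeticSubgroup))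
    (α : Measure (G₂).center') [α.IsHaarMeasure] [SFinite α] :
    ∃ (ρH : ∀ c : 𝒞, Measure ↥((G₂).quotientSubgroup ⊓ Subgroup.centralizer
        ({((Quotient.out (c : ConjClasses (G₂).arithmeticSubgroup) : (G₂).arithmeticSubgroup) :
          (G₂).Adelic)} : Set (G₂).Adelic)))
      (ρF : ∀ c : 𝒞, Measure ↥(((G₂).quotientSubgroup ⊓ Subgroup.centralizer
        ({((Quotient.out (c : ConjClasses (G₂).arithmeticSubgroup) : (G₂).arithmeticSubgroup) :
          (G₂).Adelic)} : Set (G₂).Adelic)).subgroupOf (Subgroup.centralizer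
            ({((Quotient.out (c : ConjClasses (G₂).arithmeticSubgroup) :
              (G₂).arithmeticSubgroup) : (G₂).Adelic)} : Set (G₂).Adelic)))),
      (∀ c, IsHaarMeasure (ρH c)) ∧ (∀ c, (ρH c).IsInvInvariant) ∧ (∀ c, SFinite (ρH c)) ∧
      (∀ c, IsHaarMeasure (ρF c)) ∧ (∀ c, (ρF c).IsInvInvariant) ∧ (∀ c, SFinite (ρF c)) ∧
      (∀ c, ρH c = (Measure.map (fun p : (G₂).center' × (G₂).arithmeticSubgroup =>
        (⟨(p.1 : (G₂).Adelic) * p.2, AdelicGroupData.mulMap_mem (G₂) p⟩ : (G₂).quotientSubgroup))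
          (α.prod count)).comap (Subgroup.inclusion inf_le_left)) ∧
      (∀ c, ρF c = Measure.map (Subgroup.subgroupOfEquivOfLe inf_le_right).symm (ρH c)) := by
  have hdisc : (G₂).IsDiscreteRational := gl_isDiscreteRational_holds 2 K
  set ρ₀ : Measure (G₂).quotientSubgroup := Measure.map
    (fun p : (G₂).center' × (G₂).arithmeticSubgroup =>
      (⟨(p.1 : (G₂).Adelic) * p.2, AdelicGroupData.mulMap_mem (G₂) p⟩ : (G₂).quotientSubgroup))
    (α.prod count) with hρ₀
  haveI : ρ₀.IsHaarMeasure :=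
    AdelicGroupData.isHaarMeasure_map_mul_prod_count (G₂) hdisc (centralRetraction 2 K)
      (continuous_centralRetraction 2 K) (centralRetraction_mem 2 K)
      (fun a ha => centralRetraction_eq_self 2 K ha) (fun γ hγ => centralRetraction_eq_one 2 K hγ) α
  haveI : ρ₀.IsMulRightInvariant := AdelicGroupData.isMulRightInvariant_quotientSubgroup_gl 2 K ρ₀
  haveI : ρ₀.IsInvInvariant := isInvInvariant_of_isMulRightInvariant ρ₀
  haveI hHcl : ∀ c : 𝒞, IsClosed ((((G₂).quotientSubgroup ⊓ Subgroup.centralizer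
      ({((Quotient.out (c : ConjClasses (G₂).arithmeticSubgroup) : (G₂).arithmeticSubgroup) :
        (G₂).Adelic)} : Set (G₂).Adelic)) : Subgroup (G₂).Adelic) : Set (G₂).Adelic) := fun c =>
    hH.inter (hCcl _)
  have hopen : ∀ c : 𝒞, IsOpen (((((G₂).quotientSubgroup ⊓ Subgroup.centralizer
      ({((Quotient.out (c : ConjClasses (G₂).arithmeticSubgroup) : (G₂).arithmeticSubgroup) :
        (G₂).Adelic)} : Set (G₂).Adelic)).subgroupOf (G₂).quotientSubgroup :
          Subgroup (G₂).quotientSubgroup)) : Set (G₂).quotientSubgroup) := fun c =>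
    AdelicGroupData.isOpen_subgroupOf_quotientSubgroup_of_center'_le (G₂) hdisc
      (centralRetraction 2 K) (continuous_centralRetraction 2 K) (centralRetraction_mem 2 K)
      (fun a ha => centralRetraction_eq_self 2 K ha) (fun γ hγ => centralRetraction_eq_one 2 K hγ)
      (AdelicGroupData.center'_le_inf_centralizer (G₂) _)
  set ρH : ∀ c : 𝒞, Measure ↥((G₂).quotientSubgroup ⊓ Subgroup.centralizer
      ({((Quotient.out (c : ConjClasses (G₂).arithmeticSubgroup) : (G₂).arithmeticSubgroup) :
        (G₂).Adelic)} : Set (G₂).Adelic)) := fun c => ρ₀.comap (Subgroup.inclusion inf_le_left)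
    with hρH
  haveI hHa : ∀ c, IsHaarMeasure (ρH c) := fun c =>
    isHaarMeasure_comap_subgroupInclusion _ _ inf_le_left (hopen c) ρ₀
  haveI hHi : ∀ c, (ρH c).IsInvInvariant := fun c =>
    isInvInvariant_comap (Subgroup.inclusion inf_le_left)
      (measurableEmbedding_subgroupInclusion _ _ inf_le_left (hHcl c)) ρ₀
  haveI hHs : ∀ c, SFinite (ρH c) := fun c => inferInstance
  set ρF : ∀ c : 𝒞, Measure ↥(((G₂).quotientSubgroup ⊓ Subgroup.centralizer
      ({((Quotient.out (c : ConjClasses (G₂).arithmeticSubgroup) : (G₂).arithmeticSubgroup) :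
        (G₂).Adelic)} : Set (G₂).Adelic)).subgroupOf (Subgroup.centralizer
          ({((Quotient.out (c : ConjClasses (G₂).arithmeticSubgroup) : (G₂).arithmeticSubgroup) :
            (G₂).Adelic)} : Set (G₂).Adelic))) :=
    fun c => Measure.map (Subgroup.subgroupOfEquivOfLe (inf_le_right :
      (G₂).quotientSubgroup ⊓ Subgroup.centralizer
        ({((Quotient.out (c : ConjClasses (G₂).arithmeticSubgroup) : (G₂).arithmeticSubgroup) :
          (G₂).Adelic)} : Set (G₂).Adelic) ≤ _)).symm (ρH c) with hρF
  have hFa : ∀ c, IsHaarMeasure (ρF c) := fun c =>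
    MulEquiv.isHaarMeasure_map (ρH c) _ (continuous_subgroupOfEquivOfLe_symm _ _ inf_le_right)
      (continuous_subgroupOfEquivOfLe _ _ inf_le_right)
  have hFi : ∀ c, (ρF c).IsInvInvariant := fun c =>
    isInvInvariant_map_mulEquiv _ (continuous_subgroupOfEquivOfLe_symm _ _ inf_le_right).measurable
      (ρH c)
  have hFs : ∀ c, SFinite (ρF c) := fun c => inferInstance
  exact ⟨ρH, ρF, hHa, hHi, hHs, hFa, hFi, hFs, fun c => rfl, fun c => rfl⟩

/-- **The elliptic terms of the trace formula for `GL₂` for complex test functions, with the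
printed volumes** (Gelbart (1975), Prop. 9.10 and Thm. 9.22 (ii); the elliptic terms of (10.15)). In
the setting of `GL2.lintegral_conjTsum_elliptic_eq_mul_tsum_covol_mul`, for every
`Φ ∈ C_c(GL₂(𝔸_K))` and Haar measure `α` on `A_G`, with `Φ_A(g) = ∫_{A_G} Φ(a⁻¹ g) dα(a)`: the elliptic
kernel `x ↦ Σ'_{γ ∈ GL₂(K), [γ] ∈ 𝒞} Φ_A(x̃ γ x̃⁻¹)` is `μ`-integrable, the orbital integrands
`y ↦ Φ_A(y γ_c y⁻¹)` are integrable for the quotient measures `ν/ν_c`, the class sum converges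
absolutely, and

  `∫_X Σ'_{γ ∈ GL₂(K), [γ] ∈ 𝒞} Φ_A(x̃ γ x̃⁻¹) dμ(x)
     = Σ'_{c ∈ 𝒞} (c_μ · vol(G_c ⧸ H_c)) · ∫_{GL₂(𝔸_K) ⧸ G_c} Φ_A(y γ_c y⁻¹) d(ν/ν_c)(y)`

(`integral_conjTsum_eq_tsum_of_lintegral_complex` with the finiteness
`GL2.lintegral_conjTsum_elliptic_enorm_lt_top`, Gelbart Lemma 9.9 / Prop. 9.10).
[cite: Gelbart1975, Prop. 9.10 and Thm. 9.22 (ii)] -/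
theorem GL2.integral_conjTsum_elliptic_eq_tsum_covol_mul
    [∀ γ : (G₂).Adelic, MeasurableSpace ((G₂).Adelic ⧸
      Subgroup.centralizer ({γ} : Set (G₂).Adelic))]
    [∀ γ : (G₂).Adelic, BorelSpace ((G₂).Adelic ⧸ Subgroup.centralizer ({γ} : Set (G₂).Adelic))]
    [∀ γ : (G₂).Adelic, MeasurableSpace (↥(Subgroup.centralizer ({γ} : Set (G₂).Adelic)) ⧸
      ((G₂).quotientSubgroup ⊓ Subgroup.centralizer ({γ} : Set (G₂).Adelic)).subgroupOf
        (Subgroup.centralizer ({γ} : Set (G₂).Adelic)))]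
    [∀ γ : (G₂).Adelic, BorelSpace (↥(Subgroup.centralizer ({γ} : Set (G₂).Adelic)) ⧸
      ((G₂).quotientSubgroup ⊓ Subgroup.centralizer ({γ} : Set (G₂).Adelic)).subgroupOf
        (Subgroup.centralizer ({γ} : Set (G₂).Adelic)))]
    [hH : IsClosed ((G₂).quotientSubgroup : Set (G₂).Adelic)]
    [hCcl : ∀ γ : (G₂).Adelic, IsClosed ((Subgroup.centralizer ({γ} : Set (G₂).Adelic) :
      Subgroup (G₂).Adelic) : Set (G₂).Adelic)]
    (μ : Measure (G₂).automorphicQuotient) [(G₂).IsAutomorphicMeasure μ]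
    (ν : Measure (G₂).Adelic) [IsHaarMeasure ν] [ν.IsMulRightInvariant]
    (ρ₀ : Measure (G₂).quotientSubgroup) [ρ₀.IsHaarMeasure] [SFinite ρ₀]
    (𝒞 : Set (ConjClasses (G₂).arithmeticSubgroup))
    (h𝒞 : ∀ c ∈ 𝒞, ∃ g : GL (Fin 2) K, Matrix.GeneralLinearGroup.map (algebraMap K 𝔸K) g =
      ((Quotient.out c : (G₂).arithmeticSubgroup) : (G₂).Adelic) ∧
        Irreducible (Matrix.charpoly (g : M₂)))
    (ρH : ∀ c : 𝒞, Measure ↥((G₂).quotientSubgroup ⊓ Subgroup.centralizer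
      ({((Quotient.out (c : ConjClasses (G₂).arithmeticSubgroup) : (G₂).arithmeticSubgroup) :
        (G₂).Adelic)} : Set (G₂).Adelic)))
    [∀ c, IsHaarMeasure (ρH c)] [∀ c, (ρH c).IsInvInvariant] [∀ c, SFinite (ρH c)]
    (ρF : ∀ c : 𝒞, Measure ↥(((G₂).quotientSubgroup ⊓ Subgroup.centralizer
      ({((Quotient.out (c : ConjClasses (G₂).arithmeticSubgroup) : (G₂).arithmeticSubgroup) :
        (G₂).Adelic)} : Set (G₂).Adelic)).subgroupOf (Subgroup.centralizer
          ({((Quotient.out (c : ConjClasses (G₂).arithmeticSubgroup) : (G₂).arithmeticSubgroup) :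
            (G₂).Adelic)} : Set (G₂).Adelic))))
    [∀ c, IsHaarMeasure (ρF c)] [∀ c, (ρF c).IsInvInvariant] [∀ c, SFinite (ρF c)]
    (νC : ∀ c : 𝒞, Measure ↥(Subgroup.centralizer
      ({((Quotient.out (c : ConjClasses (G₂).arithmeticSubgroup) : (G₂).arithmeticSubgroup) :
        (G₂).Adelic)} : Set (G₂).Adelic)))
    [∀ c, IsHaarMeasure (νC c)] [∀ c, (νC c).IsMulRightInvariant] [∀ c, (νC c).IsInvInvariant]
    [∀ c, SFinite (νC c)]
    (hρH : ∀ c, ρH c = ρ₀.comap (Subgroup.inclusion inf_le_left))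
    (hρF : ∀ c, ρF c = Measure.map (Subgroup.subgroupOfEquivOfLe inf_le_right).symm (ρH c))
    (α : Measure (G₂).center') [α.IsHaarMeasure] [SFinite α]
    (Φ : CompactlySupportedContinuousMap (G₂).Adelic ℂ) :
    Integrable (conjTsum (G₂).quotientSubgroup
        (((↑) : (G₂).arithmeticSubgroup → (G₂).Adelic) ''
          {γ : (G₂).arithmeticSubgroup | ConjClasses.mk γ ∈ 𝒞})
        (conj_mem_of_mk_mem (G₂).arithmeticSubgroup 𝒞 (G₂).quotientSubgroup
          (AdelicGroupData.exists_inv_mul_mem_centralizer_quotientSubgroup (G₂)))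
        (fun g => ∫ a, Φ ((a : (G₂).Adelic)⁻¹ * g) ∂α)) μ ∧
    (∀ c : 𝒞, Integrable (descConj
        ((Quotient.out (c : ConjClasses (G₂).arithmeticSubgroup) : (G₂).arithmeticSubgroup) :
          (G₂).Adelic)
        (Subgroup.centralizer ({((Quotient.out (c : ConjClasses (G₂).arithmeticSubgroup) :
          (G₂).arithmeticSubgroup) : (G₂).Adelic)} : Set (G₂).Adelic))
        (mem_centralizer_singleton_comm _) (fun g => ∫ a, Φ ((a : (G₂).Adelic)⁻¹ * g) ∂α))
        (quotientMeasure (Subgroup.centralizer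
          ({((Quotient.out (c : ConjClasses (G₂).arithmeticSubgroup) :
            (G₂).arithmeticSubgroup) : (G₂).Adelic)} : Set (G₂).Adelic)) (νC c) (hCcl _) ν)) ∧
    Summable (fun c : 𝒞 => ((unfoldingConstant (G₂).quotientSubgroup ρ₀ μ ν : ℝ≥0∞) *
        quotientMeasure (((G₂).quotientSubgroup ⊓ Subgroup.centralizer
          ({((Quotient.out (c : ConjClasses (G₂).arithmeticSubgroup) :
            (G₂).arithmeticSubgroup) : (G₂).Adelic)} : Set (G₂).Adelic)).subgroupOf
          (Subgroup.centralizer ({((Quotient.out (c : ConjClasses (G₂).arithmeticSubgroup) :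
            (G₂).arithmeticSubgroup) : (G₂).Adelic)} : Set (G₂).Adelic))) (ρF c)
          (isClosed_subgroupOf _ _ (hH.inter (hCcl _))) (νC c) Set.univ).toReal *
      ∫ y, ‖descConj
        ((Quotient.out (c : ConjClasses (G₂).arithmeticSubgroup) : (G₂).arithmeticSubgroup) :
          (G₂).Adelic)
        (Subgroup.centralizer ({((Quotient.out (c : ConjClasses (G₂).arithmeticSubgroup) :
          (G₂).arithmeticSubgroup) : (G₂).Adelic)} : Set (G₂).Adelic))
        (mem_centralizer_singleton_comm _) (fun g => ∫ a, Φ ((a : (G₂).Adelic)⁻¹ * g) ∂α) y‖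
        ∂(quotientMeasure (Subgroup.centralizer
          ({((Quotient.out (c : ConjClasses (G₂).arithmeticSubgroup) :
            (G₂).arithmeticSubgroup) : (G₂).Adelic)} : Set (G₂).Adelic)) (νC c) (hCcl _) ν)) ∧
    ∫ x, conjTsum (G₂).quotientSubgroup
        (((↑) : (G₂).arithmeticSubgroup → (G₂).Adelic) ''
          {γ : (G₂).arithmeticSubgroup | ConjClasses.mk γ ∈ 𝒞})
        (conj_mem_of_mk_mem (G₂).arithmeticSubgroup 𝒞 (G₂).quotientSubgroup
          (AdelicGroupData.exists_inv_mul_mem_centralizer_quotientSubgroup (G₂)))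
        (fun g => ∫ a, Φ ((a : (G₂).Adelic)⁻¹ * g) ∂α) x ∂μ =
      ∑' c : 𝒞, ((((unfoldingConstant (G₂).quotientSubgroup ρ₀ μ ν : ℝ≥0∞) *
        quotientMeasure (((G₂).quotientSubgroup ⊓ Subgroup.centralizer
          ({((Quotient.out (c : ConjClasses (G₂).arithmeticSubgroup) :
            (G₂).arithmeticSubgroup) : (G₂).Adelic)} : Set (G₂).Adelic)).subgroupOf
          (Subgroup.centralizer ({((Quotient.out (c : ConjClasses (G₂).arithmeticSubgroup) :
            (G₂).arithmeticSubgroup) : (G₂).Adelic)} : Set (G₂).Adelic))) (ρF c)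
          (isClosed_subgroupOf _ _ (hH.inter (hCcl _))) (νC c) Set.univ).toReal : ℝ) : ℂ) *
        ∫ y, descConj
          ((Quotient.out (c : ConjClasses (G₂).arithmeticSubgroup) : (G₂).arithmeticSubgroup) :
            (G₂).Adelic)
          (Subgroup.centralizer ({((Quotient.out (c : ConjClasses (G₂).arithmeticSubgroup) :
            (G₂).arithmeticSubgroup) : (G₂).Adelic)} : Set (G₂).Adelic))
          (mem_centralizer_singleton_comm _) (fun g => ∫ a, Φ ((a : (G₂).Adelic)⁻¹ * g) ∂α) y
          ∂(quotientMeasure (Subgroup.centralizer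
            ({((Quotient.out (c : ConjClasses (G₂).arithmeticSubgroup) :
              (G₂).arithmeticSubgroup) : (G₂).Adelic)} : Set (G₂).Adelic)) (νC c) (hCcl _) ν) := by
  -- the `[0, ∞]`-valued identity with `d_c = c_μ · vol_c`
  have hId := fun (F : (G₂).Adelic → ℝ≥0∞) (hF : Measurable F) =>
    GL2.lintegral_conjTsum_elliptic_eq_mul_tsum_covol_mul K μ ν ρ₀ 𝒞 h𝒞 ρH ρF νC hρH hρF hF
  haveI : ∀ c : 𝒞, CompactSpace (↥(Subgroup.centralizer ({((Quotient.out
      (c : ConjClasses (G₂).arithmeticSubgroup) : (G₂).arithmeticSubgroup) : (G₂).Adelic)} :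
        Set (G₂).Adelic)) ⧸ ((G₂).quotientSubgroup ⊓ Subgroup.centralizer ({((Quotient.out
      (c : ConjClasses (G₂).arithmeticSubgroup) : (G₂).arithmeticSubgroup) : (G₂).Adelic)} :
        Set (G₂).Adelic)).subgroupOf (Subgroup.centralizer ({((Quotient.out
      (c : ConjClasses (G₂).arithmeticSubgroup) : (G₂).arithmeticSubgroup) : (G₂).Adelic)} :
        Set (G₂).Adelic))) := by
    rintro ⟨c, hc⟩
    obtain ⟨g, hg, hirr⟩ := h𝒞 c hc
    have h := GL2.compactSpace_centralizer_quotient K g hirr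
    have hg' : (G₂).toAdelic g = ((Quotient.out c : (G₂).arithmeticSubgroup) : (G₂).Adelic) := hg
    rw [hg'] at h
    exact h
  haveI hHcl : ∀ c : 𝒞, IsClosed ((((G₂).quotientSubgroup ⊓ Subgroup.centralizer
      ({((Quotient.out (c : ConjClasses (G₂).arithmeticSubgroup) : (G₂).arithmeticSubgroup) :
        (G₂).Adelic)} : Set (G₂).Adelic)) : Subgroup (G₂).Adelic) : Set (G₂).Adelic) := fun c =>
    hH.inter (hCcl _)
  -- the constants are non-zero
  have hρ0 : ρ₀ ≠ 0 := fun h => by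
    have h2 : 0 < ρ₀ Set.univ := isOpen_univ.measure_pos ρ₀ ⟨1, trivial⟩
    rw [h] at h2; exact lt_irrefl _ h2
  have hc0 : (unfoldingConstant (G₂).quotientSubgroup ρ₀ μ ν : ℝ≥0∞) ≠ 0 :=
    ENNReal.coe_ne_zero.2 (unfoldingConstant_pos (G₂).quotientSubgroup ρ₀ μ ν
      (AdelicGroupData.IsAutomorphicMeasure.ne_zero (G₂) μ) hρ0).ne'
  have hd0 : ∀ c : 𝒞, (unfoldingConstant (G₂).quotientSubgroup ρ₀ μ ν : ℝ≥0∞) *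
      quotientMeasure (((G₂).quotientSubgroup ⊓ Subgroup.centralizer
        ({((Quotient.out (c : ConjClasses (G₂).arithmeticSubgroup) :
          (G₂).arithmeticSubgroup) : (G₂).Adelic)} : Set (G₂).Adelic)).subgroupOf
        (Subgroup.centralizer ({((Quotient.out (c : ConjClasses (G₂).arithmeticSubgroup) :
          (G₂).arithmeticSubgroup) : (G₂).Adelic)} : Set (G₂).Adelic))) (ρF c)
        (isClosed_subgroupOf _ _ (hH.inter (hCcl _))) (νC c) Set.univ ≠ 0 := fun c =>
    mul_ne_zero hc0 (Measure.measure_univ_ne_zero.2 (quotientMeasure_ne_zero _ (ρF c) _ (νC c)))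
  -- rewrite the identity in the form `Σ' d_c * ∫⁻`
  have hId' : ∀ F : (G₂).Adelic → ℝ≥0∞, Measurable F →
      ∫⁻ x, conjTsum (G₂).quotientSubgroup
        (((↑) : (G₂).arithmeticSubgroup → (G₂).Adelic) ''
          {γ : (G₂).arithmeticSubgroup | ConjClasses.mk γ ∈ 𝒞})
        (conj_mem_of_mk_mem (G₂).arithmeticSubgroup 𝒞 (G₂).quotientSubgroup
          (AdelicGroupData.exists_inv_mul_mem_centralizer_quotientSubgroup (G₂))) F x ∂μ =
      ∑' c : 𝒞, ((unfoldingConstant (G₂).quotientSubgroup ρ₀ μ ν : ℝ≥0∞) *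
        quotientMeasure (((G₂).quotientSubgroup ⊓ Subgroup.centralizer
          ({((Quotient.out (c : ConjClasses (G₂).arithmeticSubgroup) :
            (G₂).arithmeticSubgroup) : (G₂).Adelic)} : Set (G₂).Adelic)).subgroupOf
          (Subgroup.centralizer ({((Quotient.out (c : ConjClasses (G₂).arithmeticSubgroup) :
            (G₂).arithmeticSubgroup) : (G₂).Adelic)} : Set (G₂).Adelic))) (ρF c)
          (isClosed_subgroupOf _ _ (hH.inter (hCcl _))) (νC c) Set.univ) *
        ∫⁻ y, descConj ((Quotient.out (c : ConjClasses (G₂).arithmeticSubgroup) :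
            (G₂).arithmeticSubgroup) : (G₂).Adelic)
          (Subgroup.centralizer ({((Quotient.out (c : ConjClasses (G₂).arithmeticSubgroup) :
            (G₂).arithmeticSubgroup) : (G₂).Adelic)} : Set (G₂).Adelic))
          (mem_centralizer_singleton_comm _) F y
          ∂quotientMeasure (Subgroup.centralizer
            ({((Quotient.out (c : ConjClasses (G₂).arithmeticSubgroup) :
              (G₂).arithmeticSubgroup) : (G₂).Adelic)} : Set (G₂).Adelic)) (νC c) (hCcl _) ν := by
    intro F hF
    rw [hId F hF, ← ENNReal.tsum_mul_left]
    exact tsum_congr fun c => by rw [mul_assoc]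
  -- measurability of `Φ_A` and the finiteness of the elliptic part
  have hΦAm : Measurable fun g : (G₂).Adelic => ∫ a, Φ ((a : (G₂).Adelic)⁻¹ * g) ∂α := by
    have hsm : StronglyMeasurable fun p : (G₂).Adelic × (G₂).center' =>
        Φ ((p.2 : (G₂).Adelic)⁻¹ * p.1) :=
      (Φ.continuous.comp (by fun_prop)).stronglyMeasurable
    exact (hsm.integral_prod_right' (ν := α)).measurable
  have hfin := GL2.lintegral_conjTsum_elliptic_enorm_lt_top K μ 𝒞 h𝒞 α Φ
  haveI := countable_image_mk_mem (G₂).arithmeticSubgroup 𝒞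
  obtain ⟨h1, h2, h3, h4⟩ := integral_conjTsum_eq_tsum_of_lintegral_complex (G₂).quotientSubgroup
    _ _ μ
    (fun c : 𝒞 => ((Quotient.out (c : ConjClasses (G₂).arithmeticSubgroup) :
      (G₂).arithmeticSubgroup) : (G₂).Adelic))
    (fun c : 𝒞 => Subgroup.centralizer ({((Quotient.out (c : ConjClasses (G₂).arithmeticSubgroup) :
      (G₂).arithmeticSubgroup) : (G₂).Adelic)} : Set (G₂).Adelic))
    (fun c => mem_centralizer_singleton_comm _)
    (fun c : 𝒞 => quotientMeasure (Subgroup.centralizer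
      ({((Quotient.out (c : ConjClasses (G₂).arithmeticSubgroup) :
        (G₂).arithmeticSubgroup) : (G₂).Adelic)} : Set (G₂).Adelic)) (νC c) (hCcl _) ν)
    hd0 hId' hΦAm hfin
  exact ⟨h1, h2, h3, h4⟩

end GL2

end Literature.NumberTheory.Automorphic
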